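import Mathlib
import HarnessLib
import Summits.HubbardSuperconductivity.HubbardSuperconductivity.Theorems.KLProgrammeKLRegimeEngineSliceFamThresholds
import Summits.HubbardSuperconductivity.HubbardSuperconductivity.Theorems.KLProgrammeKLRegimeEngineSliceTelScalars

/-!
# Route `KLProgramme` — crux K3 ENGINE (stmt-HubbardSuperconductivity-20437) stub (b) conj. 2 «(c-D)² FAMILY TELESCOPE», brick (D5p): the
# THRESHOLD PACK — the eleven family thresholds and the time condition of `rowSumWt_sliceCT_famBand_tel_le`, in its binder spelling, from the
# uniform rate constant `Q` (`…EngineSliceFamRateAtoms`), ONE scale condition `W ≤ x₀` and three rate conditions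

Cell `gate-hubbard-kl`, seat hubbard-kl-k3c3-p2 (g11); F1-DESIGN §10.  Binders = the family piece's abbreviation block (generic `Λ_m = lam`,
`c = βL²`, `P2M = 2M`), plus: the atom facts of `famIncr_rates_uniform` for BOTH families (`t, t_v ≤ T₀`), its `∀`-conclusion `hQ` for a fixed `Q`,
`Y` with `1/lam ≤ Y`, `1/lam² ≤ Y`, `1 ≤ Y ≤ W`, `1/Λ ≤ W ≤ x₀`, the rate conditions `ℭρ³ ≤ 8/π³`, `3𝔴ρ₃² ≤ 16/π²` (`famIncr_thresholds_of_scale`),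
and the time data `Λ ≤ lam`, `s₀·P2M ≤ 2σΛβ`, `π³σ³Θ_t ≤ 4` (`telTime_of_sigma`).

* **`famTel_thresholds_pack`** — (the eleven thresholds) ∧ (the time condition).

Pure bookkeeping; no definitions, no sorry. [folklore]
-/

noncomputable section

namespace Summit.HubbardSuperconductivity.HubbardSuperconductivity.Theorems.TorusFourierL2

set_option linter.dupNamespace false -- summit = problem name (single-conjunct summit), D-0017

open Real Literature.MathematicalPhysics.QuantumLattice Literature.MathematicalPhysics.QuantumLattice.BandSectorCounting

section Pack

set_option maxHeartbeats 1000000 -- the long binder list (re-elaborated by every `variable` command)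

variable {a b : ℝ} (B : BandBounds a b) {A lam e₀ d Ba3 Nr Kb₂ Λ c β P2M x₀ G₀ Gi₁ Gi₂ Gi₃ ε₃₀ ε₃₁ bs b₂ b₂' b₃ b₃' B₁ B₂ B₃ : ℝ} {m : ℕ}
  -- the FAMILY piece's names (as in `rowSumWt_sliceCT_famBand_tel_le`, with `lam = klScale e₀ m`)
  {ρf κ C₁ ε₂ ζ t 𝔮₁ 𝔮₂ 𝔮₃₀ 𝔮₃₁ d₁ w₁ d₂ w₂ d₃₀ d₃₁ w₃₀ w₃₁ o₁₀ o₁₁ o₂₀ o₂₁ o₂₂ o₃₀ o₃₁ o₃₂ o₃₃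
    R₁₀ R₁₁ R₂₀ R₂₁ R₂₂ R₃₀ R₃₁ R₃₂ R₃₃ r₁₀ r₁₁ r₂₀ r₂₁ r₂₂ r₃₀ r₃₁ r₃₂ r₃₃
    tv 𝔳₁ 𝔳₂ 𝔳₃₀ 𝔳₃₁ dv₁ wv₁ dv₂ wv₂ dv₃₀ dv₃₁ wv₃₀ wv₃₁ ov₁₀ ov₁₁ ov₂₀ ov₂₁ ov₂₂ ov₃₀ ov₃₁ ov₃₂ ov₃₃
    Rv₁₀ Rv₁₁ Rv₂₀ Rv₂₁ Rv₂₂ Rv₃₀ Rv₃₁ Rv₃₂ Rv₃₃ rv₁₀ rv₁₁ rv₂₀ rv₂₁ rv₂₂ rv₃₀ rv₃₁ rv₃₂ rv₃₃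
    qt₁ qt₂ qt₃ Dt₁ Dt₂ θ₁ θ₂ θ₃ : ℝ}
  (hρf : ρf = (lam + B.smax * B.Dtmin * (3 * sectorWidth (m + 1) / 4)) / (B.Dtmin - 2 * A) +
    π * Real.sqrt 2 * (1 + (4 + 2 * A) / (B.Dtmin - 2 * A)) * sectorWidth (m + 1))
  (hκ : κ = e₀ ^ 2 / lam ^ 2) (hC₁ : C₁ = d * e₀ ^ 2 / lam ^ 2)
  (hε₂ : ε₂ = 4 + 4 * A) (hζ : ζ = 1 + 6 * (sectorWidth (m + 1))⁻¹)
  -- iso family (`t = 4 + 2A`)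
  (ht : t = 4 + 2 * A)
  (h𝔮₁ : 𝔮₁ = 2 * (d * e₀ ^ 2) * t / lam + 9 * (12 * Ba3 * ζ))
  (h𝔮₂ : 𝔮₂ = (4 * (d * e₀ ^ 4) + 2 * (d * e₀ ^ 2)) * t ^ 2 / lam ^ 2 + 2 * (d * e₀ ^ 2) * (4 + 4 * A) / lam +
    4 * (d * e₀ ^ 2) * t / lam * (9 * (12 * Ba3 * ζ)) + 9 * ((12 * Ba3 + 72 * Ba3 ^ 2) * ζ ^ 2))
  (h𝔮₃₀ : 𝔮₃₀ = (8 * (d * e₀ ^ 6) + 12 * (d * e₀ ^ 4)) * t ^ 3 / lam ^ 3 + (12 * (d * e₀ ^ 4) + 6 * (d * e₀ ^ 2)) * (t * (4 + 4 * A)) / lam ^ 2 +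
    2 * (d * e₀ ^ 2) * ε₃₀ / lam +
    3 * (((4 * (d * e₀ ^ 4) + 2 * (d * e₀ ^ 2)) * t ^ 2 / lam ^ 2 + 2 * (d * e₀ ^ 2) * (4 + 4 * A) / lam) * (9 * (12 * Ba3 * ζ))) +
    3 * (2 * (d * e₀ ^ 2) * t / lam * (9 * ((12 * Ba3 + 72 * Ba3 ^ 2) * ζ ^ 2))) + 9 * ((12 * Ba3 + 216 * Ba3 ^ 2) * ζ ^ 3))
  (h𝔮₃₁ : 𝔮₃₁ = 2 * (d * e₀ ^ 2) * ε₃₁ / lam)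
  (hd₁ : d₁ = 4 * lam * t) (hw₁ : w₁ = 2 * (t * G₀ + 2 * lam * (2 * Gi₁) + G₀ * (2 * Gi₁))) (hd₂ : d₂ = 2 * (t ^ 2 + 2 * lam * ε₂))
  (hw₂ : w₂ = 2 * (ε₂ * G₀ + 2 * t * (2 * Gi₁) + 2 * lam * (4 * Gi₂) + (2 * Gi₁) ^ 2 + G₀ * (4 * Gi₂)))
  (hd₃₀ : d₃₀ = 2 * (3 * t * ε₂ + 2 * lam * ε₃₀)) (hd₃₁ : d₃₁ = 4 * lam * ε₃₁)
  (hw₃₀ : w₃₀ = 2 * (ε₃₀ * G₀ + ε₃₁ * G₀ + 3 * ε₂ * (2 * Gi₁) + 3 * t * (4 * Gi₂) + 3 * (2 * Gi₁) * (4 * Gi₂) + G₀ * (8 * Gi₃))) (hw₃₁ : w₃₁ = 4 * lam * (8 * Gi₃))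
  (ho₁₀ : o₁₀ = t / lam) (ho₁₁ : o₁₁ = 2 * (2 * Gi₁) / G₀) (ho₂₀ : o₂₀ = ε₂ / lam + (2 * Gi₁) ^ 2 / (lam * G₀))
  (ho₂₁ : o₂₁ = 2 * t * (2 * Gi₁) / (lam * G₀)) (ho₂₂ : o₂₂ = 2 * (4 * Gi₂) / G₀)
  (ho₃₀ : o₃₀ = ε₃₀ / lam) (ho₃₁ : o₃₁ = ε₃₁ / lam + 3 * ε₂ * (2 * Gi₁) / (lam * G₀) + 3 * (2 * Gi₁) * (4 * Gi₂) / (lam * G₀))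
  (ho₃₂ : o₃₂ = 3 * t * (4 * Gi₂) / (lam * G₀)) (ho₃₃ : o₃₃ = 2 * (8 * Gi₃) / G₀)
  (hR₁₀ : R₁₀ = κ * (d₁ + w₁) + o₁₀) (hR₁₁ : R₁₁ = o₁₁)
  (hR₂₀ : R₂₀ = κ ^ 2 * (d₁ + w₁) ^ 2 + κ * (o₁₀ * (2 * d₁ + w₁)) + κ * (d₂ + w₂) + o₂₀) (hR₂₁ : R₂₁ = κ * (o₁₁ * (2 * d₁ + w₁)) + o₂₁)
  (hR₂₂ : R₂₂ = o₂₂)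
  (hR₃₀ : R₃₀ = κ ^ 3 * (d₁ + w₁) ^ 3 + κ ^ 2 * (o₁₀ * (3 * d₁ ^ 2 + 3 * d₁ * w₁ + w₁ ^ 2)) +
    3 * (κ ^ 2 * ((d₁ + w₁) * (d₂ + w₂)) + κ * (d₁ * o₂₀ + o₁₀ * d₂ + o₁₀ * w₂)) + κ * (d₃₀ + w₃₀) + o₃₀)
  (hR₃₁ : R₃₁ = κ ^ 2 * (o₁₁ * (3 * d₁ ^ 2 + 3 * d₁ * w₁ + w₁ ^ 2)) + 3 * (κ * (d₁ * o₂₁ + o₁₁ * d₂ + o₁₁ * w₂)) + κ * (d₃₁ + w₃₁) + o₃₁)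
  (hR₃₂ : R₃₂ = 3 * (κ * (d₁ * o₂₂)) + o₃₂) (hR₃₃ : R₃₃ = o₃₃)
  (hr₁₀ : r₁₀ = R₁₀ + 𝔮₁) (hr₁₁ : r₁₁ = R₁₁) (hr₂₀ : r₂₀ = R₂₀ + 2 * R₁₀ * 𝔮₁ + 𝔮₂) (hr₂₁ : r₂₁ = R₂₁ + 2 * R₁₁ * 𝔮₁) (hr₂₂ : r₂₂ = R₂₂)
  (hr₃₀ : r₃₀ = R₃₀ + 3 * R₂₀ * 𝔮₁ + 3 * R₁₀ * 𝔮₂ + 𝔮₃₀) (hr₃₁ : r₃₁ = R₃₁ + 3 * R₂₁ * 𝔮₁ + 3 * R₁₁ * 𝔮₂ + 𝔮₃₁)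
  (hr₃₂ : r₃₂ = R₃₂ + 3 * R₂₂ * 𝔮₁) (hr₃₃ : r₃₃ = R₃₃)
  -- tangent family (`t_v = (4+2A)/(N_r−1) + K₂√2ρ_f`)
  (htv : tv = (4 + 2 * A) / (Nr - 1) + Kb₂ * (Real.sqrt 2 * ρf))
  (h𝔳₁ : 𝔳₁ = 2 * (d * e₀ ^ 2) * tv / lam + 9 * (12 * Ba3 * ζ))
  (h𝔳₂ : 𝔳₂ = (4 * (d * e₀ ^ 4) + 2 * (d * e₀ ^ 2)) * tv ^ 2 / lam ^ 2 + 2 * (d * e₀ ^ 2) * (4 + 4 * A) / lam +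
    4 * (d * e₀ ^ 2) * tv / lam * (9 * (12 * Ba3 * ζ)) + 9 * ((12 * Ba3 + 72 * Ba3 ^ 2) * ζ ^ 2))
  (h𝔳₃₀ : 𝔳₃₀ = (8 * (d * e₀ ^ 6) + 12 * (d * e₀ ^ 4)) * tv ^ 3 / lam ^ 3 + (12 * (d * e₀ ^ 4) + 6 * (d * e₀ ^ 2)) * (tv * (4 + 4 * A)) / lam ^ 2 +
    2 * (d * e₀ ^ 2) * ε₃₀ / lam +
    3 * (((4 * (d * e₀ ^ 4) + 2 * (d * e₀ ^ 2)) * tv ^ 2 / lam ^ 2 + 2 * (d * e₀ ^ 2) * (4 + 4 * A) / lam) * (9 * (12 * Ba3 * ζ))) +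
    3 * (2 * (d * e₀ ^ 2) * tv / lam * (9 * ((12 * Ba3 + 72 * Ba3 ^ 2) * ζ ^ 2))) + 9 * ((12 * Ba3 + 216 * Ba3 ^ 2) * ζ ^ 3))
  (h𝔳₃₁ : 𝔳₃₁ = 2 * (d * e₀ ^ 2) * ε₃₁ / lam)
  (hdv₁ : dv₁ = 4 * lam * tv) (hwv₁ : wv₁ = 2 * (tv * G₀ + 2 * lam * (2 * Gi₁) + G₀ * (2 * Gi₁))) (hdv₂ : dv₂ = 2 * (tv ^ 2 + 2 * lam * ε₂))
  (hwv₂ : wv₂ = 2 * (ε₂ * G₀ + 2 * tv * (2 * Gi₁) + 2 * lam * (4 * Gi₂) + (2 * Gi₁) ^ 2 + G₀ * (4 * Gi₂)))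
  (hdv₃₀ : dv₃₀ = 2 * (3 * tv * ε₂ + 2 * lam * ε₃₀)) (hdv₃₁ : dv₃₁ = 4 * lam * ε₃₁)
  (hwv₃₀ : wv₃₀ = 2 * (ε₃₀ * G₀ + ε₃₁ * G₀ + 3 * ε₂ * (2 * Gi₁) + 3 * tv * (4 * Gi₂) + 3 * (2 * Gi₁) * (4 * Gi₂) + G₀ * (8 * Gi₃))) (hwv₃₁ : wv₃₁ = 4 * lam * (8 * Gi₃))
  (hov₁₀ : ov₁₀ = tv / lam) (hov₁₁ : ov₁₁ = 2 * (2 * Gi₁) / G₀) (hov₂₀ : ov₂₀ = ε₂ / lam + (2 * Gi₁) ^ 2 / (lam * G₀))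
  (hov₂₁ : ov₂₁ = 2 * tv * (2 * Gi₁) / (lam * G₀)) (hov₂₂ : ov₂₂ = 2 * (4 * Gi₂) / G₀)
  (hov₃₀ : ov₃₀ = ε₃₀ / lam) (hov₃₁ : ov₃₁ = ε₃₁ / lam + 3 * ε₂ * (2 * Gi₁) / (lam * G₀) + 3 * (2 * Gi₁) * (4 * Gi₂) / (lam * G₀))
  (hov₃₂ : ov₃₂ = 3 * tv * (4 * Gi₂) / (lam * G₀)) (hov₃₃ : ov₃₃ = 2 * (8 * Gi₃) / G₀)
  (hRv₁₀ : Rv₁₀ = κ * (dv₁ + wv₁) + ov₁₀) (hRv₁₁ : Rv₁₁ = ov₁₁)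
  (hRv₂₀ : Rv₂₀ = κ ^ 2 * (dv₁ + wv₁) ^ 2 + κ * (ov₁₀ * (2 * dv₁ + wv₁)) + κ * (dv₂ + wv₂) + ov₂₀) (hRv₂₁ : Rv₂₁ = κ * (ov₁₁ * (2 * dv₁ + wv₁)) + ov₂₁)
  (hRv₂₂ : Rv₂₂ = ov₂₂)
  (hRv₃₀ : Rv₃₀ = κ ^ 3 * (dv₁ + wv₁) ^ 3 + κ ^ 2 * (ov₁₀ * (3 * dv₁ ^ 2 + 3 * dv₁ * wv₁ + wv₁ ^ 2)) +
    3 * (κ ^ 2 * ((dv₁ + wv₁) * (dv₂ + wv₂)) + κ * (dv₁ * ov₂₀ + ov₁₀ * dv₂ + ov₁₀ * wv₂)) + κ * (dv₃₀ + wv₃₀) + ov₃₀)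
  (hRv₃₁ : Rv₃₁ = κ ^ 2 * (ov₁₁ * (3 * dv₁ ^ 2 + 3 * dv₁ * wv₁ + wv₁ ^ 2)) + 3 * (κ * (dv₁ * ov₂₁ + ov₁₁ * dv₂ + ov₁₁ * wv₂)) + κ * (dv₃₁ + wv₃₁) + ov₃₁)
  (hRv₃₂ : Rv₃₂ = 3 * (κ * (dv₁ * ov₂₂)) + ov₃₂) (hRv₃₃ : Rv₃₃ = ov₃₃)
  (hrv₁₀ : rv₁₀ = Rv₁₀ + 𝔳₁) (hrv₁₁ : rv₁₁ = Rv₁₁) (hrv₂₀ : rv₂₀ = Rv₂₀ + 2 * Rv₁₀ * 𝔳₁ + 𝔳₂) (hrv₂₁ : rv₂₁ = Rv₂₁ + 2 * Rv₁₁ * 𝔳₁) (hrv₂₂ : rv₂₂ = Rv₂₂)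
  (hrv₃₀ : rv₃₀ = Rv₃₀ + 3 * Rv₂₀ * 𝔳₁ + 3 * Rv₁₀ * 𝔳₂ + 𝔳₃₀) (hrv₃₁ : rv₃₁ = Rv₃₁ + 3 * Rv₂₁ * 𝔳₁ + 3 * Rv₁₁ * 𝔳₂ + 𝔳₃₁)
  (hrv₃₂ : rv₃₂ = Rv₃₂ + 3 * Rv₂₂ * 𝔳₁) (hrv₃₃ : rv₃₃ = Rv₃₃)
  -- time
  (hqt₁ : qt₁ = 2 * (d * e₀ ^ 2) * |2 * π / β| / lam) (hqt₂ : qt₂ = (4 * (d * e₀ ^ 4) + 2 * (d * e₀ ^ 2)) * (2 * π / β) ^ 2 / lam ^ 2)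
  (hqt₃ : qt₃ = (8 * (d * e₀ ^ 6) + 12 * (d * e₀ ^ 4)) * |2 * π / β| ^ 3 / lam ^ 3)
  (hDt₁ : Dt₁ = 2 * lam * |2 * π / β|) (hDt₂ : Dt₂ = 2 * (2 * π / β) ^ 2)
  (hθ₁ : θ₁ = κ * Dt₁ + qt₁) (hθ₂ : θ₂ = κ ^ 2 * Dt₁ ^ 2 + κ * Dt₂ + 2 * (κ * Dt₁) * qt₁ + qt₂)
  (hθ₃ : θ₃ = κ ^ 3 * Dt₁ ^ 3 + 3 * (κ ^ 2 * (Dt₁ * Dt₂)) + 3 * ((κ ^ 2 * Dt₁ ^ 2 + κ * Dt₂) * qt₁) + 3 * (κ * Dt₁ * qt₂) + qt₃)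
  -- the cutoff polynomials and the threshold coefficients (`c = βL²`)
  {k₁ k₂ k₃ : ℝ}
  (hk₁ : k₁ = (16 * B₁ + 16) / Λ ^ 2) (hk₂ : k₂ = (32 * B₂ + 144 * B₁ + 128) / Λ ^ 3) (hk₃ : k₃ = (64 * B₃ + 480 * B₂ + 1728 * B₁ + 1536) / Λ ^ 4)
  {C₀ C₁' C₂ C₃ Cv₀ Cv₁ Cv₂ Cv₃ Cw₀ Cw₁ Cw₂ Kc Kw : ℝ}
  (hC₀ : C₀ = 343 * k₃ * c * bs ^ 3 + 21 * k₂ * c * bs * b₂ + k₁ * c * b₃ +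
    3 * r₁₀ * (36 * k₂ * c * bs ^ 2 + k₁ * c * b₂) + 15 * r₂₀ * k₁ * c * bs + r₃₀ * (4 * c / Λ))
  (hC₁' : C₁' = 21 * k₂ * c * bs * b₂' + k₁ * c * b₃' + 3 * r₁₁ * (36 * k₂ * c * bs ^ 2 + k₁ * c * b₂) +
    3 * r₁₀ * (k₁ * c * b₂') + 15 * r₂₁ * k₁ * c * bs + r₃₁ * (4 * c / Λ))
  (hC₂ : C₂ = 3 * r₁₁ * (k₁ * c * b₂') + 15 * r₂₂ * k₁ * c * bs + r₃₂ * (4 * c / Λ))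
  (hC₃ : C₃ = r₃₃ * (4 * c / Λ))
  (hCv₀ : Cv₀ = 343 * k₃ * c * bs ^ 3 + 21 * k₂ * c * bs * b₂ + k₁ * c * b₃ +
    3 * rv₁₀ * (36 * k₂ * c * bs ^ 2 + k₁ * c * b₂) + 15 * rv₂₀ * k₁ * c * bs + rv₃₀ * (4 * c / Λ))
  (hCv₁ : Cv₁ = 21 * k₂ * c * bs * b₂' + k₁ * c * b₃' + 3 * rv₁₁ * (36 * k₂ * c * bs ^ 2 + k₁ * c * b₂) +
    3 * rv₁₀ * (k₁ * c * b₂') + 15 * rv₂₁ * k₁ * c * bs + rv₃₁ * (4 * c / Λ))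
  (hCv₂ : Cv₂ = 3 * rv₁₁ * (k₁ * c * b₂') + 15 * rv₂₂ * k₁ * c * bs + rv₃₂ * (4 * c / Λ))
  (hCv₃ : Cv₃ = rv₃₃ * (4 * c / Λ))
  (hCw₀ : Cw₀ = 25 * k₂ * c * bs ^ 2 + k₁ * c * b₂ + 8 * rv₁₀ * k₁ * c * bs + rv₂₀ * (4 * c / Λ))
  (hCw₁ : Cw₁ = k₁ * c * b₂' + 8 * rv₁₁ * k₁ * c * bs + rv₂₁ * (4 * c / Λ))
  (hCw₂ : Cw₂ = rv₂₂ * (4 * c / Λ))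
  (hKc : Kc = 32 * c / (π ^ 3 * Λ)) (hKw : Kw = 16 * c / (π ^ 2 * Λ))

include h𝔮₁ h𝔮₂ h𝔮₃₀ h𝔮₃₁ hd₁ hw₁ hd₂ hw₂ hd₃₀ hd₃₁ hw₃₀ hw₃₁ ho₁₀ ho₁₁ ho₂₀ ho₂₁ ho₂₂ ho₃₀ ho₃₁ ho₃₂ ho₃₃ hR₁₀ hR₁₁ hR₂₀ hR₂₁ hR₂₂ hR₃₀ hR₃₁ hR₃₂ hR₃₃
  hr₁₀ hr₁₁ hr₂₀ hr₂₁ hr₂₂ hr₃₀ hr₃₁ hr₃₂ hr₃₃ h𝔳₁ h𝔳₂ h𝔳₃₀ h𝔳₃₁ hdv₁ hwv₁ hdv₂ hwv₂ hdv₃₀ hdv₃₁ hwv₃₀ hwv₃₁ hov₁₀ hov₁₁ hov₂₀ hov₂₁ hov₂₂ hov₃₀ hov₃₁ hov₃₂ hov₃₃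
  hRv₁₀ hRv₁₁ hRv₂₀ hRv₂₁ hRv₂₂ hRv₃₀ hRv₃₁ hRv₃₂ hRv₃₃ hrv₁₀ hrv₁₁ hrv₂₀ hrv₂₁ hrv₂₂ hrv₃₀ hrv₃₁ hrv₃₂ hrv₃₃ hqt₁ hqt₂ hqt₃ hDt₁ hDt₂ hθ₁ hθ₂ hθ₃
  hk₁ hk₂ hk₃ hC₀ hC₁' hC₂ hC₃ hCv₀ hCv₁ hCv₂ hCv₃ hCw₀ hCw₁ hCw₂ hKc hKw in
set_option maxHeartbeats 4000000 in
/-- **The threshold pack of the family telescope** (see the module docstring). [folklore] -/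
theorem famTel_thresholds_pack
    -- atoms
    {T₀ E₀ E₁ zc g₀ g₁ g₂ g₃ γ₁ γ₂ γ₃ Q Y W ρ ρ₃ σ s₀ ℭ 𝔴 : ℝ}
    (hlam : 0 < lam) (hlam1 : lam ≤ 1) (hY1 : 1 ≤ Y) (hY : 1 / lam ≤ Y) (hY2 : 1 / lam ^ 2 ≤ Y) (ht0 : 0 ≤ t) (htT : t ≤ T₀)
    (htv0 : 0 ≤ tv) (htvT : tv ≤ T₀) (hG₀ : 0 < G₀) (hG₀g : G₀ ≤ g₀) (hG₁γ : Gi₁ = γ₁ * G₀) (hG₂γ : Gi₂ = γ₂ * G₀) (hG₃γ : Gi₃ = γ₃ * G₀)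
    (hG₁g : Gi₁ ≤ g₁) (hG₂g : Gi₂ ≤ g₂) (hG₃g : Gi₃ ≤ g₃) (hζ0 : 0 ≤ ζ) (hζY : ζ ≤ zc * Y) (hε₃₀0 : 0 ≤ ε₃₀) (hε₃₀E : ε₃₀ ≤ E₀)
    (hε₃₁0 : 0 ≤ ε₃₁) (hε₃₁E : ε₃₁ ≤ E₁) (hκe : κ = e₀ ^ 2 / lam ^ 2)
    (hQ : ∀ (lam Y t G₀ G₁ G₂ G₃ ζ ε₃₀ ε₃₁ κ 𝔮₁ 𝔮₂ 𝔮₃₀ 𝔮₃₁ d₁ w₁ d₂ w₂ d₃₀ d₃₁ w₃₀ w₃₁ o₁₀ o₁₁ o₂₀ o₂₁ o₂₂ o₃₀ o₃₁ o₃₂ o₃₃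
        R₁₀ R₁₁ R₂₀ R₂₁ R₂₂ R₃₀ R₃₁ R₃₂ R₃₃ r₁₀ r₁₁ r₂₀ r₂₁ r₂₂ r₃₀ r₃₁ r₃₂ r₃₃ : ℝ),
      0 < lam → lam ≤ 1 → 1 ≤ Y → 1 / lam ≤ Y → 1 / lam ^ 2 ≤ Y → 0 ≤ t → t ≤ T₀ →
      0 < G₀ → G₀ ≤ g₀ → G₁ = γ₁ * G₀ → G₂ = γ₂ * G₀ → G₃ = γ₃ * G₀ → G₁ ≤ g₁ → G₂ ≤ g₂ → G₃ ≤ g₃ →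
      0 ≤ ζ → ζ ≤ zc * Y → 0 ≤ ε₃₀ → ε₃₀ ≤ E₀ → 0 ≤ ε₃₁ → ε₃₁ ≤ E₁ → κ = e₀ ^ 2 / lam ^ 2 →
      𝔮₁ = 2 * (d * e₀ ^ 2) * t / lam + 9 * (12 * Ba3 * ζ) →
      𝔮₂ = (4 * (d * e₀ ^ 4) + 2 * (d * e₀ ^ 2)) * t ^ 2 / lam ^ 2 + 2 * (d * e₀ ^ 2) * (4 + 4 * A) / lam +
        4 * (d * e₀ ^ 2) * t / lam * (9 * (12 * Ba3 * ζ)) + 9 * ((12 * Ba3 + 72 * Ba3 ^ 2) * ζ ^ 2) →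
      𝔮₃₀ = (8 * (d * e₀ ^ 6) + 12 * (d * e₀ ^ 4)) * t ^ 3 / lam ^ 3 + (12 * (d * e₀ ^ 4) + 6 * (d * e₀ ^ 2)) * (t * (4 + 4 * A)) / lam ^ 2 +
        2 * (d * e₀ ^ 2) * ε₃₀ / lam +
        3 * (((4 * (d * e₀ ^ 4) + 2 * (d * e₀ ^ 2)) * t ^ 2 / lam ^ 2 + 2 * (d * e₀ ^ 2) * (4 + 4 * A) / lam) * (9 * (12 * Ba3 * ζ))) +
        3 * (2 * (d * e₀ ^ 2) * t / lam * (9 * ((12 * Ba3 + 72 * Ba3 ^ 2) * ζ ^ 2))) + 9 * ((12 * Ba3 + 216 * Ba3 ^ 2) * ζ ^ 3) →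
      𝔮₃₁ = 2 * (d * e₀ ^ 2) * ε₃₁ / lam →
      d₁ = 4 * lam * t → w₁ = 2 * (t * G₀ + 2 * lam * (2 * G₁) + G₀ * (2 * G₁)) → d₂ = 2 * (t ^ 2 + 2 * lam * ε₂) →
      w₂ = 2 * (ε₂ * G₀ + 2 * t * (2 * G₁) + 2 * lam * (4 * G₂) + (2 * G₁) ^ 2 + G₀ * (4 * G₂)) →
      d₃₀ = 2 * (3 * t * ε₂ + 2 * lam * ε₃₀) → d₃₁ = 4 * lam * ε₃₁ →
      w₃₀ = 2 * (ε₃₀ * G₀ + ε₃₁ * G₀ + 3 * ε₂ * (2 * G₁) + 3 * t * (4 * G₂) + 3 * (2 * G₁) * (4 * G₂) + G₀ * (8 * G₃)) → w₃₁ = 4 * lam * (8 * G₃) →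
      o₁₀ = t / lam → o₁₁ = 2 * (2 * G₁) / G₀ → o₂₀ = ε₂ / lam + (2 * G₁) ^ 2 / (lam * G₀) → o₂₁ = 2 * t * (2 * G₁) / (lam * G₀) →
      o₂₂ = 2 * (4 * G₂) / G₀ → o₃₀ = ε₃₀ / lam →
      o₃₁ = ε₃₁ / lam + 3 * ε₂ * (2 * G₁) / (lam * G₀) + 3 * (2 * G₁) * (4 * G₂) / (lam * G₀) → o₃₂ = 3 * t * (4 * G₂) / (lam * G₀) →
      o₃₃ = 2 * (8 * G₃) / G₀ →
      R₁₀ = κ * (d₁ + w₁) + o₁₀ → R₁₁ = o₁₁ →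
      R₂₀ = κ ^ 2 * (d₁ + w₁) ^ 2 + κ * (o₁₀ * (2 * d₁ + w₁)) + κ * (d₂ + w₂) + o₂₀ → R₂₁ = κ * (o₁₁ * (2 * d₁ + w₁)) + o₂₁ → R₂₂ = o₂₂ →
      R₃₀ = κ ^ 3 * (d₁ + w₁) ^ 3 + κ ^ 2 * (o₁₀ * (3 * d₁ ^ 2 + 3 * d₁ * w₁ + w₁ ^ 2)) +
        3 * (κ ^ 2 * ((d₁ + w₁) * (d₂ + w₂)) + κ * (d₁ * o₂₀ + o₁₀ * d₂ + o₁₀ * w₂)) + κ * (d₃₀ + w₃₀) + o₃₀ →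
      R₃₁ = κ ^ 2 * (o₁₁ * (3 * d₁ ^ 2 + 3 * d₁ * w₁ + w₁ ^ 2)) + 3 * (κ * (d₁ * o₂₁ + o₁₁ * d₂ + o₁₁ * w₂)) + κ * (d₃₁ + w₃₁) + o₃₁ →
      R₃₂ = 3 * (κ * (d₁ * o₂₂)) + o₃₂ → R₃₃ = o₃₃ →
      r₁₀ = R₁₀ + 𝔮₁ → r₁₁ = R₁₁ → r₂₀ = R₂₀ + 2 * R₁₀ * 𝔮₁ + 𝔮₂ → r₂₁ = R₂₁ + 2 * R₁₁ * 𝔮₁ → r₂₂ = R₂₂ →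
      r₃₀ = R₃₀ + 3 * R₂₀ * 𝔮₁ + 3 * R₁₀ * 𝔮₂ + 𝔮₃₀ → r₃₁ = R₃₁ + 3 * R₂₁ * 𝔮₁ + 3 * R₁₁ * 𝔮₂ + 𝔮₃₁ → r₃₂ = R₃₂ + 3 * R₂₂ * 𝔮₁ → r₃₃ = R₃₃ →
      r₁₀ ≤ Q * Y ∧ r₁₁ ≤ Q ∧ r₂₀ ≤ Q * Y ^ 2 ∧ r₂₁ ≤ Q * Y ∧ r₂₂ ≤ Q ∧ r₃₀ ≤ Q * Y ^ 3 ∧ r₃₁ ≤ Q * Y ^ 2 ∧ r₃₂ ≤ Q * Y ∧ r₃₃ ≤ Q)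
    -- scale and rates
    (hΛ : 0 < Λ) (hΛlam : Λ ≤ lam) (hc : 0 < c) (hβ : 0 < β) (hYW : Y ≤ W) (hΛW : 1 / Λ ≤ W) (hQ0 : 0 ≤ Q) (hρ : 0 < ρ) (hρ₃ : 0 < ρ₃) (hx₀ : W ≤ x₀)
    (hbs : 0 ≤ bs) (hb₂ : 0 ≤ b₂) (hb₂' : 0 ≤ b₂') (hb₃ : 0 ≤ b₃) (hb₃' : 0 ≤ b₃') (hB₁ : 0 ≤ B₁) (hB₂ : 0 ≤ B₂) (hB₃ : 0 ≤ B₃)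
    (hℭ : ℭ = (343 * (64 * B₃ + 480 * B₂ + 1728 * B₁ + 1536) * bs ^ 3 + 21 * (32 * B₂ + 144 * B₁ + 128) * bs * b₂ + (16 * B₁ + 16) * b₃ +
        3 * Q * (36 * (32 * B₂ + 144 * B₁ + 128) * bs ^ 2 + (16 * B₁ + 16) * b₂) + 15 * Q * (16 * B₁ + 16) * bs + 4 * Q) +
      (21 * (32 * B₂ + 144 * B₁ + 128) * bs * b₂' + (16 * B₁ + 16) * b₃' + 3 * Q * (36 * (32 * B₂ + 144 * B₁ + 128) * bs ^ 2 + (16 * B₁ + 16) * b₂) +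
        3 * Q * ((16 * B₁ + 16) * b₂') + 15 * Q * (16 * B₁ + 16) * bs + 4 * Q) +
      (3 * Q * ((16 * B₁ + 16) * b₂') + 15 * Q * (16 * B₁ + 16) * bs + 4 * Q) + 4 * Q)
    (h𝔴 : 𝔴 = (25 * (32 * B₂ + 144 * B₁ + 128) * bs ^ 2 + (16 * B₁ + 16) * b₂ + 8 * Q * (16 * B₁ + 16) * bs + 4 * Q) +
      ((16 * B₁ + 16) * b₂' + 8 * Q * (16 * B₁ + 16) * bs + 4 * Q) + 4 * Q)
    (hρℭ : ℭ * ρ ^ 3 ≤ 8 / π ^ 3) (hρ𝔴 : 3 * 𝔴 * ρ₃ ^ 2 ≤ 16 / π ^ 2)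
    -- time
    (hd : 0 ≤ d) (hs₀ : 0 < s₀) (hP2M : 0 < P2M) (hσ : 0 < σ) (hsM : s₀ * P2M ≤ 2 * σ * Λ * β)
    (hΘ : π ^ 3 * σ ^ 3 * ((64 * B₃ + 480 * B₂ + 1728 * B₁ + 1536) + 3 * (2 * e₀ ^ 2 + 2 * (d * e₀ ^ 2)) * (32 * B₂ + 144 * B₁ + 128) +
      3 * (4 * e₀ ^ 4 + 2 * e₀ ^ 2 + 8 * (d * e₀ ^ 4) + (4 * (d * e₀ ^ 4) + 2 * (d * e₀ ^ 2))) * (16 * B₁ + 16) +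
      4 * (8 * e₀ ^ 6 + 12 * e₀ ^ 4 + 6 * (d * e₀ ^ 2) * (4 * e₀ ^ 4 + 2 * e₀ ^ 2) + 6 * e₀ ^ 2 * (4 * (d * e₀ ^ 4) + 2 * (d * e₀ ^ 2)) +
        (8 * (d * e₀ ^ 6) + 12 * (d * e₀ ^ 4)))) ≤ 4) :
    ((4 * C₃ * ρ ^ 3 ≤ Kc ∧ 4 * C₂ * ρ ^ 3 ≤ Kc * x₀ ∧ 4 * C₁' * ρ ^ 3 ≤ Kc * x₀ ^ 2 ∧ 4 * C₀ * ρ ^ 3 ≤ Kc * x₀ ^ 3) ∧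
    (4 * Cv₃ * ρ ^ 3 ≤ Kc ∧ 4 * Cv₂ * ρ ^ 3 ≤ Kc * x₀ ∧ 4 * Cv₁ * ρ ^ 3 ≤ Kc * x₀ ^ 2 ∧ 4 * Cv₀ * ρ ^ 3 ≤ Kc * x₀ ^ 3) ∧
    (3 * Cw₂ * ρ₃ ^ 2 ≤ Kw ∧ 3 * Cw₁ * ρ₃ ^ 2 ≤ Kw * x₀ ∧ 3 * Cw₀ * ρ₃ ^ 2 ≤ Kw * x₀ ^ 2)) ∧
    ((1 / c) ^ 2 *
        (1 * ((2 * π / β) ^ 3 * ((64 * B₃ + 480 * B₂ + 1728 * B₁ + 1536) * c / Λ ^ 4)) +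
          3 * (θ₁ * ((2 * π / β) ^ 2 * ((32 * B₂ + 144 * B₁ + 128) * c / Λ ^ 3))) +
          3 * (θ₂ * ((2 * π / β) * ((16 * B₁ + 16) * c / Λ ^ 2))) +
          θ₃ * (4 * c / Λ)) ≤
      (1 / c) ^ 2 * (4 * c / Λ) * (4 / (s₀ * P2M)) ^ 3) := by
  -- the two rate families through the uniform constant
  have hr := hQ lam Y t G₀ Gi₁ Gi₂ Gi₃ ζ ε₃₀ ε₃₁ κ 𝔮₁ 𝔮₂ 𝔮₃₀ 𝔮₃₁ d₁ w₁ d₂ w₂ d₃₀ d₃₁ w₃₀ w₃₁ o₁₀ o₁₁ o₂₀ o₂₁ o₂₂ o₃₀ o₃₁ o₃₂ o₃₃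
    R₁₀ R₁₁ R₂₀ R₂₁ R₂₂ R₃₀ R₃₁ R₃₂ R₃₃ r₁₀ r₁₁ r₂₀ r₂₁ r₂₂ r₃₀ r₃₁ r₃₂ r₃₃
    hlam hlam1 hY1 hY hY2 ht0 htT hG₀ hG₀g hG₁γ hG₂γ hG₃γ hG₁g hG₂g hG₃g hζ0 hζY hε₃₀0 hε₃₀E hε₃₁0 hε₃₁E hκe
    h𝔮₁ h𝔮₂ h𝔮₃₀ h𝔮₃₁ hd₁ hw₁ hd₂ hw₂ hd₃₀ hd₃₁ hw₃₀ hw₃₁ ho₁₀ ho₁₁ ho₂₀ ho₂₁ ho₂₂ ho₃₀ ho₃₁ ho₃₂ ho₃₃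
    hR₁₀ hR₁₁ hR₂₀ hR₂₁ hR₂₂ hR₃₀ hR₃₁ hR₃₂ hR₃₃ hr₁₀ hr₁₁ hr₂₀ hr₂₁ hr₂₂ hr₃₀ hr₃₁ hr₃₂ hr₃₃
  have hrv := hQ lam Y tv G₀ Gi₁ Gi₂ Gi₃ ζ ε₃₀ ε₃₁ κ 𝔳₁ 𝔳₂ 𝔳₃₀ 𝔳₃₁ dv₁ wv₁ dv₂ wv₂ dv₃₀ dv₃₁ wv₃₀ wv₃₁ ov₁₀ ov₁₁ ov₂₀ ov₂₁ ov₂₂ ov₃₀ ov₃₁ ov₃₂ ov₃₃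
    Rv₁₀ Rv₁₁ Rv₂₀ Rv₂₁ Rv₂₂ Rv₃₀ Rv₃₁ Rv₃₂ Rv₃₃ rv₁₀ rv₁₁ rv₂₀ rv₂₁ rv₂₂ rv₃₀ rv₃₁ rv₃₂ rv₃₃
    hlam hlam1 hY1 hY hY2 htv0 htvT hG₀ hG₀g hG₁γ hG₂γ hG₃γ hG₁g hG₂g hG₃g hζ0 hζY hε₃₀0 hε₃₀E hε₃₁0 hε₃₁E hκe
    h𝔳₁ h𝔳₂ h𝔳₃₀ h𝔳₃₁ hdv₁ hwv₁ hdv₂ hwv₂ hdv₃₀ hdv₃₁ hwv₃₀ hwv₃₁ hov₁₀ hov₁₁ hov₂₀ hov₂₁ hov₂₂ hov₃₀ hov₃₁ hov₃₂ hov₃₃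
    hRv₁₀ hRv₁₁ hRv₂₀ hRv₂₁ hRv₂₂ hRv₃₀ hRv₃₁ hRv₃₂ hRv₃₃ hrv₁₀ hrv₁₁ hrv₂₀ hrv₂₁ hrv₂₂ hrv₃₀ hrv₃₁ hrv₃₂ hrv₃₃
  obtain ⟨i₁₀, i₁₁, i₂₀, i₂₁, i₂₂, i₃₀, i₃₁, i₃₂, i₃₃⟩ := hr
  obtain ⟨j₁₀, j₁₁, j₂₀, j₂₁, j₂₂, j₃₀, j₃₁, j₃₂, j₃₃⟩ := hrv
  refine ⟨famIncr_thresholds_of_scale hΛ hc hY1 hYW hΛW hQ0 hρ hρ₃ hx₀ hbs hb₂ hb₂' hb₃ hb₃' hB₁ hB₂ hB₃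
    i₁₀ i₁₁ i₂₀ i₂₁ i₂₂ i₃₀ i₃₁ i₃₂ i₃₃ j₁₀ j₁₁ j₂₀ j₂₁ j₂₂ j₃₀ j₃₁ j₃₂ j₃₃ hk₁ hk₂ hk₃ hC₀ hC₁' hC₂ hC₃ hCv₀ hCv₁ hCv₂ hCv₃ hCw₀ hCw₁ hCw₂ hKc hKw
    hℭ h𝔴 hρℭ hρ𝔴, ?_⟩
  exact telTime_of_sigma hc hΛ hΛlam hβ hd hs₀ hP2M hσ hsM hB₁ hB₂ hκe hqt₁ hqt₂ hqt₃ hDt₁ hDt₂ hθ₁ hθ₂ hθ₃ hΘ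

end Pack

end Summit.HubbardSuperconductivity.HubbardSuperconductivity.Theorems.TorusFourierL2

end
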